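import Summits.BirchSwinnertonDyer.Rank1Residual.X5.TwoAdicTargetsMultKatoRat
import Literature.NumberTheory.EllipticCurves.Kato2004.DivisibilityInputsMultiplicative
import Literature.NumberTheory.EllipticCurves.Greenberg1999.SelmerCotorsionMultiplicative
import Literature.NumberTheory.EllipticCurves.TateModuleContinuityProofs
import HarnessLib

/-!
# K11 in the KERNEL modulo located inputs, part 1: the assembly `X5.O1.KatoMultiplicativeDivisibilityRat W p`
# from sign-wise §17.13 package providers, and K11 at every ODD multiplicative prime from LITERATURE facts
# (part 2, `…MultKatoRatOfInputsTwo.lean`: `p = 2` from the two Summits-side `p = 2` package constants)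

Cell `bsd-2adic` (run/shared/lean/pub/bsd-2adic/), seat `bsd-2adic-mult` GEN 9; HUMAN RULINGS D-0036 /
D-0054; director (Q2) 2026-08-26 «make it a KERNEL theorem». HONEST FRAMING: research route; nothing is
asserted; no class is closed here; no count moves. PARTITION: X5@2 multiplicative (K4ᵐ, RESIDUAL-MAP
B1·O1; 1 976 book230 classes) × p = 2 — types-the-object-of; bears_on K4 items 19922 / 19923.

WHAT THIS FILE DOES. The prime-uniform research binder of the whole multiplicative-at-`2` lane,
`X5.O1.KatoMultiplicativeDivisibilityRat W p` (`X5/TwoAdicTargetsMultKatoRat.lean` :79; its `p = 2`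
projections are K11a `X5.O1.KatoDivisibilityAtTwoNonsplitMultRat` and K11b-Rat
`X5.O1.KatoDivisibilityAtTwoSplitMultRat`, the `hK`/`hKato` of every mult END door, of the
MultTowerClass rows, of t42's transport rows), hitherto an `@[conjecture] def` proved only in the cell
memos PROOF-MULT / PROOF-KATO2MULT / PROOF-KATO2SPLIT, is here a KERNEL THEOREM modulo named inputs:
* `katoMultiplicativeDivisibilityRat_of_packages` — the assembly at a fixed `(W, p)`: package providers
  for the two signs (each «some `Kato2004.MultDivisibilityInputs W p L κ γ I D` with its sign clause»)
  + `Kato2004.nonempty_iwasawaH1Data` + `Kato2004.thm12_4` (accepted Literature facts, any prime) +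
  `Greenberg1999.thm15_isTorsion_multiplicative_rat` (LNM 1716 Thm. 1.5, PRINT; used only to cover the
  degenerate value `L = 0` of the universally quantified `L`) ⇒ `X5.O1.KatoMultiplicativeDivisibilityRat W p`,
  by the PROVED module theory `Kato2004.katoDivisibility_{nonsplit,split}Mult_of_inputs`
  (`Kato2004.exists_mem_charIdeal_of_skeleton_upTo` / the exceptional-zero skeleton
  `Kato2004.exists_X_mul_mem_charIdeal_of_skeleton_exceptional`); the `ℤ_p`-continuity of `T_pW` is
  DISCHARGED (`TateModule.continuousSMul_padicInt`), not displayed;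
* `katoMultiplicativeDivisibilityRat_of_facts_odd` — ODD `p`: the providers are the LITERATURE
  construction facts `Kato2004.exists_multDivisibilityInputs_{nonsplit,split}` (Kato 2004 §§12–17 +
  Wuthrich 2014 p. 391 / Kobayashi 2006 Thm. 4.1 + Greenberg §2, all printed at odd `p`) — Kato's `⊗ℚ`
  divisibility at an odd multiplicative prime, BOTH signs, NO image hypothesis, kernel ∘ print;
* (companion file `ByReductionTypeAtTwoMultKatoRatOfInputsTwo.lean`)
  `katoMultiplicativeDivisibilityRat_two_of_inputs` (+ `…_forall_…`, K11a / K11b-Rat projections) —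
  `p = 2`: the providers are the two Summits-side `@[conjecture]` constants of
  `ByReductionTypeAtTwoMultKatoInputsDefs.lean` (the `p = 2` siblings of the Literature facts; their
  ONLY unprinted field is the Coleman-map injectivity / `I`-valuedness at `2` — cell memos, referee
  RC-2/RC-28/RC-35/RC-41 PASS; audit reading `Kato17.11@2-nonsplit`).
WHY THIS IS NOVEL (for the cell). Before: K11 at `2` = a Summits `@[conjecture]` of GLOBAL shape
(`char X ∣ 2ⁿL`) + three memos. After: K11 at `2` = kernel ∘ {2 accepted Kato facts, h15 PRINT, 2 typed
LOCAL packages whose single unprinted field is named}; at odd `p` K11 is kernel ∘ print outright.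
WHAT THIS IS NOT: not a proof of Prop. 17.11 / Kobayashi 4.1 at `2`; not the integral clause
(T-KATO2-{NS,SP}MULT stay memo binders); not Greenberg–Stevens; no class closes; nothing is booked.

References: [Kato2004Asterisque] Thm. 12.4, 12.5, 12.6 (pp. 221–222), §16 (pp. 268–271), Prop. 17.11,
Lemma 17.12, §17.13 (pp. 277–280), Rem. 18.3 (p. 281); [Wuthrich2014] p. 391, Cor. 19 (p. 398);
[Kobayashi2006DocMath] Thm. 4.1; [GreenbergLNM1716] Thm. 1.5, §2; [MazurTateTeitelbaum1986] §I.10,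
§I.14–15; cell files HOME/audit/D-AUDIT-K11a-Kato-mult-at-2-print-locator.md, HOME/mult/*.md.
-/

set_option autoImplicit false
-- the Theorems namespace of this sub repeats the summit name by design (D-0017 nested layout: Summit.<S>.<Sub>)
set_option linter.dupNamespace false

noncomputable section

open scoped Classical MatrixGroups ModularForm

open CongruenceSubgroup WeierstrassCurve Literature.NumberTheory.EllipticCurves
  Literature.NumberTheory.EllipticCurves.ModularForms
  Literature.NumberTheory.EllipticCurves.Rank1Residual
  Literature.NumberTheory.EllipticCurves.Greenberg1999
  Summit.BirchSwinnertonDyer.Rank1Residual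

namespace Summit.BirchSwinnertonDyer.BirchSwinnertonDyer.Theorems.MultKatoRat

variable (W : WeierstrassCurve ℚ) [W.IsElliptic] [W.IsGloballyMinimal] (p : ℕ) [Fact p.Prime]

/-- **Assembly at a fixed `(W, p)`: K11 from package providers.** If, at the prime `p`, for every
newform `f` of `W`, every cyclotomic `κ`/`γ`, every MTT function `L` and every `I`, `D`, SOME
`Kato2004.MultDivisibilityInputs W p L κ γ I D` exists with the non-split clause (`𝐇²_loc`-term zero at
the height-one `𝔭 ∌ p`) when `W` is non-split at `p`, resp. with the split clause (`col(P) ⊆ (T)`) when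
`W` is split at `p`, then — with `nonempty_iwasawaH1Data`, `thm12_4` and Greenberg's Thm. 1.5 — the
binder `X5.O1.KatoMultiplicativeDivisibilityRat W p` holds: `X` torsion (Thm. 1.5); the divisibility
clauses for `L = 0` with `g = 0`, for `L ≠ 0` by `Kato2004.katoDivisibility_{nonsplit,split}Mult_of_inputs`.
The `ℤ_p`-continuity instance of `T_pW` is supplied by `TateModule.continuousSMul_padicInt`.
[cite: Kato2004Asterisque, Thm. 17.4 (1)(2) (p. 273; shape), Thm. 12.5 (3) (p. 222), §17.13 (pp. 279–280)]
[cite: GreenbergLNM1716, Thm. 1.5 (PDF p. 61)] -/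
theorem katoMultiplicativeDivisibilityRat_of_packages (hne : Kato2004.nonempty_iwasawaH1Data)
    (h12 : Kato2004.thm12_4) (h15 : thm15_isTorsion_multiplicative_rat)
    (hns : ∀ [ContinuousSMul ℤ_[p] (W.tateModule p)] {N : ℕ} [NeZero N] (f : CuspForm (Gamma0 N) 2)
      (κ : ZpExtension ℚ p) (γ : Field.absoluteGaloisGroup ℚ),
      W.HasMultiplicativeReductionAtPrime p → ¬ W.HasSplitMultiplicativeReductionAtPrime p →
      κ.IsCyclotomic → κ.IsTopGenerator γ → IsCyclotomicVariable p γ → IsNewformOf W f →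
      ∀ (L : PowerSeries ℚ_[p]), IsMultPAdicLFunctionOf f p (-1) L →
      ∀ (I : Kato2004.IwasawaH1Data W p κ γ) (D : W.SelmerDualData κ γ),
        ∃ K : Kato2004.MultDivisibilityInputs W p L κ γ I D,
          ∀ 𝔭 : PrimeSpectrum (IwasawaAlgebra p), 𝔭.asIdeal.height = 1 →
            PowerSeries.C (p : ℤ_[p]) ∉ 𝔭.asIdeal →
              Literature.NumberTheory.EllipticCurves.Module.lengthAt (IwasawaAlgebra p) K.H2loc 𝔭 = 0)
    (hsp : ∀ [ContinuousSMul ℤ_[p] (W.tateModule p)] {N : ℕ} [NeZero N] (f : CuspForm (Gamma0 N) 2)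
      (κ : ZpExtension ℚ p) (γ : Field.absoluteGaloisGroup ℚ),
      W.HasSplitMultiplicativeReductionAtPrime p →
      κ.IsCyclotomic → κ.IsTopGenerator γ → IsCyclotomicVariable p γ → IsNewformOf W f →
      ∀ (L : PowerSeries ℚ_[p]), IsSplitMultPAdicLFunctionOf f p L →
      ∀ (I : Kato2004.IwasawaH1Data W p κ γ) (D : W.SelmerDualData κ γ),
        ∃ K : Kato2004.MultDivisibilityInputs W p L κ γ I D,
          ∀ y : K.P, K.col y ∈ Ideal.span {(PowerSeries.X : IwasawaAlgebra p)}) :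
    X5.O1.KatoMultiplicativeDivisibilityRat W p := by
  haveI : ContinuousSMul ℤ_[p] (W.tateModule p) := TateModule.continuousSMul_padicInt
  intro κ γ hκ hγ hγ' hmult N _ f hf D
  refine ⟨h15 W p hmult f hf κ γ hκ hγ D, fun hnsp L hL => ?_, fun hspl L hL => ?_⟩
  · by_cases hL0 : L = 0
    · exact ⟨0, 0, Submodule.zero_mem _, by simp [hL0]⟩
    · obtain ⟨I⟩ := hne W p κ γ hκ hγ
      obtain ⟨K, hK⟩ := hns f κ γ hmult hnsp hκ hγ hγ' hf L hL I D
      obtain ⟨-, n, g, hg, hι⟩ := Kato2004.katoDivisibility_nonsplitMult_of_inputs h12 hκ hγ K hK hL0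
      exact ⟨n, g, hg, hι⟩
  · by_cases hL0 : L = 0
    · exact ⟨0, 0, Submodule.zero_mem _, by simp [hL0]⟩
    · obtain ⟨I⟩ := hne W p κ γ hκ hγ
      obtain ⟨K, hK⟩ := hsp f κ γ hspl hκ hγ hγ' hf L hL I D
      obtain ⟨-, n, g, hg, hι⟩ :=
        Kato2004.katoDivisibility_splitMult_of_inputs h12 hκ hγ K hK hL0 hL.constantCoeff_eq_zero
      exact ⟨n, g, hg, hι⟩

/-- **K11 at an ODD multiplicative prime — kernel ∘ PRINT.** For every prime `p ≠ 2`: the Literature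
facts `Kato2004.nonempty_iwasawaH1Data`, `Kato2004.thm12_4`,
`Kato2004.exists_multDivisibilityInputs_nonsplit`, `Kato2004.exists_multDivisibilityInputs_split`
(Kato 2004 §§12–17 at a multiplicative odd prime, Wuthrich 2014 p. 391, Kobayashi 2006 Thm. 4.1,
Greenberg §2) and `Greenberg1999.thm15_isTorsion_multiplicative_rat` imply
`X5.O1.KatoMultiplicativeDivisibilityRat W p` — Kato's `⊗ℚ` divisibility at `p ∥ N`, both signs, no
image hypothesis. [cite: Kato2004Asterisque, Thm. 17.4 (1)(2) (p. 273; shape) and §17.13 (pp. 279–280)]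
[cite: Wuthrich2014, p. 391 and Cor. 19 (p. 398)] [cite: Kobayashi2006DocMath, Thm. 4.1] -/
theorem katoMultiplicativeDivisibilityRat_of_facts_odd (hp : p ≠ 2)
    (hne : Kato2004.nonempty_iwasawaH1Data) (h12 : Kato2004.thm12_4)
    (hns : Kato2004.exists_multDivisibilityInputs_nonsplit)
    (hsp : Kato2004.exists_multDivisibilityInputs_split)
    (h15 : thm15_isTorsion_multiplicative_rat) : X5.O1.KatoMultiplicativeDivisibilityRat W p :=
  katoMultiplicativeDivisibilityRat_of_packages W p hne h12 h15
    (fun f κ γ hm hn hκ hγ hγ' hf L hL I D => hns W p f κ γ hp hm hn hκ hγ hγ' hf L hL I D)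
    (fun f κ γ hs hκ hγ hγ' hf L hL I D => hsp W p f κ γ hp hs hκ hγ hγ' hf L hL I D)

end Summit.BirchSwinnertonDyer.BirchSwinnertonDyer.Theorems.MultKatoRat

end
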